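import Summits.FinalStateConjecture.FinalStateConjecture.Theorems.SwallowTheDatumParametricKerrBurialStubSiteMarginAux1
import Summits.FinalStateConjecture.FinalStateConjecture.Theorems.SwallowTheDatumParametricKerrBurialStubSiteMarginAux2

/-!
# `ParametricKerrBurial`, line `receding-annulus-universal-collar` — stub `stub_siteMargin` (BK1)
# (crux item stmt-FinalStateConjecture-10052), the registered statement proved

The abstract Mao–Oh–Tao site lemma of the Brill–Lindquist bulk: for an admissible bump `η` and thresholds `εo, μo` there are a mass
ceiling `m₀`, a relative margin `κ` and a deviation constant `cdev` such that for masses `0 ≤ mIn`, `8 mIn ≤ mOut`, `0 < mOut ≤ m₀`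
the hypothesis block `MOTHyp` of Thm 1.7 (engine file `SwallowTheDatumParametricKerrBurialEngine.lean`, §1) holds for IN = the exact
time-symmetric isotropic Schwarzschild(`mIn`) field `schwField mIn` with deviation bound `cdev·mIn`, against ANY time-symmetric OUT
metric field `gOut ∈ C^∞({16 < ‖x‖})` which is `κ·mOut`-close in `C²` on `{32 ≤ ‖x‖ ≤ 64}` to `schwField mOut`.

Proof (helper files `…StubSiteMarginAux1.lean` = exact field, `…StubSiteMarginAux2.lean` = perturbation at radius `32`):
`k = 0` kills `P`, `J`; the exact charges are `12 m ≤ E ≤ 48 m` at both radii and `C = 0`; by additivity and the local charge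
bound the OUT charges move by at most `18 W κ mOut ≤ mOut` (`E`) and `1170 W κ mOut ≤ μo mOut` (`C_l`), `W = ∫|η_32(|x|)|dx`,
once `κ (1170 W + 18) ≤ min(1, μo)`; hence `5 mOut ≤ ΔE ≤ 49 mOut` and the five inequalities follow for
`m₀ = min(1/(4∫|η|), εo²/50, μo/(cdev² + (c₃₂ + κ)² + 1))`, `sOut = (c₃₂ + κ) mOut` (triangle inequality for `DevLE`, this file).

References: Mao–Oh–Tao arXiv:2308.13031 Thm 1.7, Rem 1.11, §1.2; the crux directory's `PICKED.md`.
-/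

set_option linter.dupNamespace false
-- the operator norm on `E3 [×m]→L[ℝ] (E3 →L[ℝ] E3 →L[ℝ] ℝ)` needs a longer instance search than the default budget
set_option synthInstance.maxHeartbeats 120000

noncomputable section

-- instance search through the nested operator types `E3 →L E3 →L ℝ`
set_option maxSynthPendingDepth 3

namespace Summit.FinalStateConjecture.FinalStateConjecture.Theorems.SwallowTheDatum.ParametricKerrBurial

open scoped Manifold ContDiff Topology BigOperators InnerProductSpace
open Bundle Set Filter Function MeasureTheory Literature.Geometry.Lorentzian
open Literature.Geometry.Lorentzian.MaoOhTao Literature.Geometry.Lorentzian.InitialDataSet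
open Summit.FinalStateConjecture.FinalStateConjecture.Theorems.SwallowTheDatum.UniversalWitnessFamily

/-! ## §1 The `C²` deviation of the OUT field -/

/-- **`DevLE` of the OUT field by the triangle inequality**: if `gOut − schwField m + δ` deviates from `(δ, 0)` by at most
`s₁` and `schwField m` from `δ` by at most `s₂` (in `C²` on `{32 ≤ ‖x‖ ≤ 64}`), then `(gOut, 0)` deviates by at most
`s₁ + s₂` (`iteratedFDeriv_add_apply` at points of smoothness). [folklore] -/
theorem sm_devLE32_of_pert {gOut : E3 → E3 →L[ℝ] E3 →L[ℝ] ℝ} {m s₁ s₂ : ℝ}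
    (hg : ContDiffOn ℝ ∞ gOut {x : E3 | 16 < ‖x‖})
    (hdev : DevLE (fun x ↦ gOut x - schwField m x + (innerSL ℝ : E3 →L[ℝ] E3 →L[ℝ] ℝ)) zeroField 32 64 s₁)
    (hc : ∀ j : ℕ, j ≤ 2 → ∀ x : E3, 32 ≤ ‖x‖ → ‖x‖ ≤ 64 →
      ‖iteratedFDeriv ℝ j (fun y : E3 ↦ schwField m y - (innerSL ℝ : E3 →L[ℝ] E3 →L[ℝ] ℝ)) x‖ ≤ s₂) :
    DevLE gOut zeroField 32 64 (s₁ + s₂) := by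
  intro x hx1 hx2
  have hx16 : 16 < ‖x‖ := by linarith
  have hx0 : x ≠ 0 := norm_pos_iff.1 (by linarith)
  obtain ⟨h1, h2⟩ := hdev x hx1 hx2
  have hs₂ : 0 ≤ s₂ := (norm_nonneg _).trans (hc 0 (by norm_num) x hx1 hx2)
  refine ⟨fun j hj ↦ ?_, fun j hj ↦ (h2 j hj).trans (le_add_of_nonneg_right hs₂)⟩
  have hsum : (fun y ↦ gOut y - (innerSL ℝ : E3 →L[ℝ] E3 →L[ℝ] ℝ)) =
      (fun y ↦ (gOut y - schwField m y + (innerSL ℝ : E3 →L[ℝ] E3 →L[ℝ] ℝ)) -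
        (innerSL ℝ : E3 →L[ℝ] E3 →L[ℝ] ℝ)) +
      fun y ↦ schwField m y - (innerSL ℝ : E3 →L[ℝ] E3 →L[ℝ] ℝ) := by
    funext y
    simp only [Pi.add_apply]
    abel
  have hgj : ContDiffAt ℝ (j : ℕ) gOut x :=
    (hg.contDiffAt (sm_isOpen_outer16.mem_nhds hx16)).of_le (by exact_mod_cast le_top)
  have hsj : ContDiffAt ℝ (j : ℕ) (schwField m) x := sm_contDiffAt_schwField m hx0
  have hc₁ : ContDiffAt ℝ (j : ℕ)
      (fun y ↦ (gOut y - schwField m y + (innerSL ℝ : E3 →L[ℝ] E3 →L[ℝ] ℝ)) -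
        (innerSL ℝ : E3 →L[ℝ] E3 →L[ℝ] ℝ)) x :=
    ((hgj.sub hsj).add contDiffAt_const).sub contDiffAt_const
  have hc₂ : ContDiffAt ℝ (j : ℕ) (fun y ↦ schwField m y - (innerSL ℝ : E3 →L[ℝ] E3 →L[ℝ] ℝ)) x :=
    hsj.sub contDiffAt_const
  rw [hsum, iteratedFDeriv_add_apply hc₁ hc₂]
  exact (norm_add_le _ _).trans (add_le_add (h1 j hj) (hc j hj x hx1 hx2))

/-! ## §2 The registered stub -/

/-- **Stub BK1 — `stub_siteMargin`** (the abstract Mao–Oh–Tao site lemma of the bulk): for the bump `η` and thresholds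
`εo, μo` there are a mass ceiling `m₀`, a relative margin `κ` and a deviation constant `cdev` such that for masses
`0 ≤ mIn`, `8 mIn ≤ mOut`, `0 < mOut ≤ m₀` the hypothesis block `MOTHyp` of Thm 1.7 holds for IN = the exact time-symmetric
isotropic Schwarzschild(`mIn`) field with deviation bound `cdev·mIn`, against ANY time-symmetric OUT metric field `κ·mOut`-close
in `C²` on `{32 ≤ ‖x‖ ≤ 64}` to `schwField mOut`.  Proof: `k = 0` kills `P, J`; the exact charges are `E ∈ [12 m, 48 m]` at
both radii (radius `1` by the dilation law) and `C = 0`; the OUT charges move by `O(κ mOut)` (additivity and the radius-`32`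
charge bound), so `ΔE ≥ 12 mOut − mOut − 48 mIn ≥ 5 mOut`; then `m₀` small after `εo, μo`. [cite: MaoOhTao2023, Thm 1.7, Rem 1.11] -/
theorem stub_siteMargin : ∀ η : ℝ → ℝ, IsBump η → ∀ (εo μo : ℝ), 0 < εo → 0 < μo →
    ∃ (m₀ κ cdev : ℝ), 0 < m₀ ∧ 0 < κ ∧ 0 ≤ cdev ∧
      ∀ (mIn mOut : ℝ), 0 ≤ mIn → 8 * mIn ≤ mOut → 0 < mOut → mOut ≤ m₀ →
        DevLE (schwField mIn) zeroField 1 2 (cdev * mIn) ∧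
        ∃ sOut : ℝ, ∀ gOut : E3 → E3 →L[ℝ] E3 →L[ℝ] ℝ,
          ContDiffOn ℝ ∞ gOut {x : E3 | 16 < ‖x‖} →
          DevLE (fun x ↦ gOut x - schwField mOut x + (innerSL ℝ : E3 →L[ℝ] E3 →L[ℝ] ℝ)) zeroField 32 64 (κ * mOut) →
          MOTHyp η εo μo (schwField mIn) zeroField gOut zeroField (cdev * mIn) sOut := by
  intro η hη εo μo hεo hμo
  -- the two deviation constants of the exact field (IN annulus `[1, 2]`, OUT annulus `[32, 64]`)
  obtain ⟨c₁, hc₁pos, hc₁⟩ := sm_exists_devBound one_pos (2 : ℝ)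
  obtain ⟨c₂, hc₂pos, hc₂⟩ := sm_exists_devBound (by norm_num : (0 : ℝ) < 32) (64 : ℝ)
  -- the bump mass `I = ∫|η| ≥ 1` and the weight mass `W = ∫|η_32(|x|)| dx ≥ 0`
  obtain ⟨I, hIdef⟩ : ∃ I : ℝ, I = ∫ s, |η s| := ⟨_, rfl⟩
  have hI1 : 1 ≤ I := hIdef ▸ schwOut_one_le_integral_abs hη
  have hI0 : 0 < I := by linarith
  obtain ⟨W, hWdef⟩ : ∃ W : ℝ, W = ∫ x : E3, |wt η 32 x| := ⟨_, rfl⟩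
  have hW : 0 ≤ W := hWdef ▸ integral_nonneg fun _ ↦ abs_nonneg _
  -- the relative margin `κ`: `1170 W κ ≤ μo`, `18 W κ ≤ 1`
  obtain ⟨L, hLdef⟩ : ∃ L : ℝ, L = 1170 * W + 18 := ⟨_, rfl⟩
  have hLpos : 0 < L := by rw [hLdef]; positivity
  obtain ⟨κ, hκdef⟩ : ∃ κ : ℝ, κ = min 1 μo / L := ⟨_, rfl⟩
  have hmin : 0 < min 1 μo := lt_min one_pos hμo
  have hκpos : 0 < κ := by rw [hκdef]; exact div_pos hmin hLpos
  have hLκ : L * κ = min 1 μo := by rw [hκdef]; exact mul_div_cancel₀ _ hLpos.ne'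
  have hκE : W * 18 * κ ≤ 1 := by
    have h : W * 18 * κ ≤ L * κ := mul_le_mul_of_nonneg_right (by rw [hLdef]; linarith) hκpos.le
    linarith [min_le_left (1 : ℝ) μo]
  have hκC : W * 1170 * κ ≤ μo := by
    have h : W * 1170 * κ ≤ L * κ := mul_le_mul_of_nonneg_right (by rw [hLdef]; linarith) hκpos.le
    linarith [min_le_right (1 : ℝ) μo]
  -- the mass ceiling
  obtain ⟨K, hKdef⟩ : ∃ K : ℝ, K = c₁ ^ 2 + (c₂ + κ) ^ 2 + 1 := ⟨_, rfl⟩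
  have hKpos : 0 < K := by rw [hKdef]; positivity
  obtain ⟨m₀, hm₀def⟩ : ∃ m₀ : ℝ, m₀ = min (min (1 / (4 * I)) (εo ^ 2 / 50)) (μo / K) := ⟨_, rfl⟩
  have hm₀pos : 0 < m₀ := by
    rw [hm₀def]
    exact lt_min (lt_min (by positivity) (by positivity)) (div_pos hμo hKpos)
  have hm₀I : m₀ ≤ 1 / (4 * I) := by rw [hm₀def]; exact (min_le_left _ _).trans (min_le_left _ _)
  have hm₀ε : m₀ ≤ εo ^ 2 / 50 := by rw [hm₀def]; exact (min_le_left _ _).trans (min_le_right _ _)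
  have hm₀K : m₀ ≤ μo / K := by rw [hm₀def]; exact min_le_right _ _
  have hm₀I' : m₀ * (4 * I) ≤ 1 := (le_div_iff₀ (by positivity)).1 hm₀I
  have hKm₀ : m₀ * K ≤ μo := (le_div_iff₀ hKpos).1 hm₀K
  refine ⟨m₀, κ, c₁, hm₀pos, hκpos, hc₁pos.le, fun mIn mOut hmIn h8 hmOut hle ↦ ?_⟩
  -- mass bookkeeping: `mOut ≤ 1`, `mOut ∫|η| ≤ 8`, `32 mIn ≤ 1`, `32 mIn ∫|η| ≤ 8`, `mIn ≤ 1`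
  have hm₀I1 : m₀ * 1 ≤ m₀ * I := mul_le_mul_of_nonneg_left hI1 hm₀pos.le
  have hm₀4 : m₀ ≤ 1 / 4 := by linarith only [hm₀I1, hm₀I']
  have hmOutI0 : mOut * I ≤ m₀ * I := mul_le_mul_of_nonneg_right hle hI0.le
  have hmOut1 : mOut ≤ 1 := by linarith only [hle, hm₀4]
  have hmOutI : mOut * ∫ s, |η s| ≤ 8 := by
    rw [← hIdef]
    linarith only [hmOutI0, hm₀I']
  have hmIn32 : 32 * mIn ≤ 1 := by linarith only [h8, hle, hm₀4]
  have hmInI : 32 * mIn * ∫ s, |η s| ≤ 8 := by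
    rw [← hIdef]
    have h : 32 * mIn * I ≤ 4 * mOut * I := mul_le_mul_of_nonneg_right (by linarith only [h8]) hI0.le
    linarith only [h, hmOutI0, hm₀I']
  have hmIn1 : mIn ≤ 1 := by linarith only [hmIn32, hmIn]
  have hdevIn : DevLE (schwField mIn) zeroField 1 2 (c₁ * mIn) := sm_devLE_schwField hc₁ hmIn hmIn1
  refine ⟨hdevIn, (c₂ + κ) * mOut, fun gOut hg hclose ↦ ?_⟩
  -- smoothness of the three fields on `{16 < ‖x‖}`
  have hg1 : ContDiffOn ℝ 1 gOut {x : E3 | 16 < ‖x‖} := hg.of_le (by exact_mod_cast le_top)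
  have hs1 : ContDiffOn ℝ 1 (schwField mOut) {x : E3 | 16 < ‖x‖} := sm_contDiffOn_schwField mOut (by norm_num)
  have hh1 : ContDiffOn ℝ 1 (fun x ↦ gOut x - schwField mOut x + (innerSL ℝ : E3 →L[ℝ] E3 →L[ℝ] ℝ))
      {x : E3 | 16 < ‖x‖} := (hg1.sub hs1).add contDiffOn_const
  have hκm : 0 ≤ κ * mOut := by positivity
  -- the OUT deviation
  have hdevOut : DevLE gOut zeroField 32 64 ((c₂ + κ) * mOut) := by
    have h := sm_devLE32_of_pert hg hclose (fun j hj x hx1 hx2 ↦ hc₂ mOut hmOut.le hmOut1 j hj x hx1 hx2)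
    rw [show (c₂ + κ) * mOut = κ * mOut + c₂ * mOut by ring]
    exact h
  -- the energies
  have hEout := sm_avgE32_schwField_bounds hη hmOut hmOut1 hmOutI
  have hEin := sm_avgE_one_schwField_bounds hη hmIn hmIn32 hmInI
  have hEsub := sm_avgE32_sub hη hg1 hs1
  have hEh := sm_abs_avgE32_le hη hh1 hκm hclose
  rw [← hWdef] at hEh
  have hWκm : W * (18 * (κ * mOut)) ≤ mOut := by
    have h := mul_le_mul_of_nonneg_right hκE hmOut.le
    linarith only [h]
  have hEh' := abs_le.1 hEh
  have hΔlo : 5 * mOut ≤ avgE η 32 gOut - avgE η 1 (schwField mIn) := by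
    linarith only [hEout.1, hEin.2, hEh'.1, hEsub, hWκm, h8]
  have hΔhi : avgE η 32 gOut - avgE η 1 (schwField mIn) ≤ 49 * mOut := by
    linarith only [hEout.2, hEin.1, hEh'.2, hEsub, hWκm, hmIn]
  have hΔpos : 0 < avgE η 32 gOut - avgE η 1 (schwField mIn) := by linarith only [hΔlo, hmOut]
  -- the momenta and angular momenta vanish (`k = 0`)
  have hP : ∀ (r : ℝ) (i : Fin 3), avgP η r zeroField i = 0 := fun r i ↦ PlugDataPlus.avgP_zero η r i
  have hJ : ∀ (r : ℝ) (i : Fin 3), avgJ η r zeroField i = 0 := fun r i ↦ PlugDataPlus.avgJ_zero η r i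
  have hSP : ∑ i : Fin 3, (avgP η 32 zeroField i - avgP η 1 zeroField i) ^ 2 = 0 := by simp [hP]
  have hSJ : ∑ i : Fin 3, (avgJ η 32 zeroField i - avgJ η 1 zeroField i) ^ 2 = 0 := by simp [hJ]
  -- the centres of mass
  have hCsub := fun l ↦ sm_avgC32_sub hη hg1 hs1 l
  have hΔC : ∀ l, |avgC η 32 gOut l - avgC η 1 (schwField mIn) l| ≤ μo * mOut := by
    intro l
    have h1 : avgC η 32 gOut l =
        avgC η 32 (fun y ↦ gOut y - schwField mOut y + (innerSL ℝ : E3 →L[ℝ] E3 →L[ℝ] ℝ)) l := by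
      have h := hCsub l
      rwa [sm_avgC32_schwField hη, sub_zero] at h
    have h2 := sm_abs_avgC32_le hη hh1 hκm hclose l
    rw [← hWdef] at h2
    rw [sm_avgC_one_schwField hη, sub_zero, h1]
    refine h2.trans ?_
    have h3 := mul_le_mul_of_nonneg_right hκC hmOut.le
    linarith only [h3]
  have hSC : ∑ l : Fin 3, (avgC η 32 gOut l - avgC η 1 (schwField mIn) l) ^ 2 ≤ 3 * (μo * mOut) ^ 2 := by
    have h3 : ∀ l, (avgC η 32 gOut l - avgC η 1 (schwField mIn) l) ^ 2 ≤ (μo * mOut) ^ 2 := fun l ↦ by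
      rw [← sq_abs]
      exact pow_le_pow_left₀ (abs_nonneg _) (hΔC l) 2
    calc _ ≤ ∑ _l : Fin 3, (μo * mOut) ^ 2 := Finset.sum_le_sum fun l _ ↦ h3 l
      _ = 3 * (μo * mOut) ^ 2 := by simp
  -- the five inequalities of Thm 1.7
  have hμΔ : μo * (5 * mOut) ≤ μo * (avgE η 32 gOut - avgE η 1 (schwField mIn)) :=
    mul_le_mul_of_nonneg_left hΔlo hμo.le
  have hμm : 0 < μo * mOut := mul_pos hμo hmOut
  have i1 : Real.sqrt (∑ i : Fin 3, (avgP η 32 zeroField i - avgP η 1 zeroField i) ^ 2) <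
      avgE η 32 gOut - avgE η 1 (schwField mIn) := by
    rw [hSP, Real.sqrt_zero]
    exact hΔpos
  have i2 : avgE η 32 gOut - avgE η 1 (schwField mIn) <
      2 * Real.sqrt ((avgE η 32 gOut - avgE η 1 (schwField mIn)) ^ 2 -
        ∑ i : Fin 3, (avgP η 32 zeroField i - avgP η 1 zeroField i) ^ 2) := by
    rw [hSP, sub_zero, Real.sqrt_sq hΔpos.le]
    linarith only [hΔpos]
  have i3 : avgE η 32 gOut - avgE η 1 (schwField mIn) < εo ^ 2 := by
    have h : (0 : ℝ) < εo ^ 2 := by positivity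
    linarith only [h, hΔhi, hle, hm₀ε]
  have i4 : Real.sqrt (∑ l : Fin 3, (avgC η 32 gOut l - avgC η 1 (schwField mIn) l) ^ 2) +
      Real.sqrt (∑ i : Fin 3, (avgJ η 32 zeroField i - avgJ η 1 zeroField i) ^ 2) <
      μo * (avgE η 32 gOut - avgE η 1 (schwField mIn)) := by
    rw [hSJ, Real.sqrt_zero, add_zero, Real.sqrt_lt' (mul_pos hμo hΔpos)]
    have h25 : (5 * (μo * mOut)) ^ 2 ≤ (μo * (avgE η 32 gOut - avgE η 1 (schwField mIn))) ^ 2 :=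
      pow_le_pow_left₀ (by positivity) (by linarith only [hμΔ]) 2
    have hsq : 0 < (μo * mOut) ^ 2 := pow_pos hμm 2
    linarith only [hSC, h25, hsq]
  have i5 : (c₁ * mIn) ^ 2 + ((c₂ + κ) * mOut) ^ 2 < μo * (avgE η 32 gOut - avgE η 1 (schwField mIn)) := by
    have hmInOut : mIn ≤ mOut := by linarith only [h8, hmIn]
    have hsq : mIn ^ 2 ≤ mOut ^ 2 := pow_le_pow_left₀ hmIn hmInOut 2
    have hsq' : c₁ ^ 2 * mIn ^ 2 ≤ c₁ ^ 2 * mOut ^ 2 := mul_le_mul_of_nonneg_left hsq (sq_nonneg c₁)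
    have hA : (c₁ * mIn) ^ 2 + ((c₂ + κ) * mOut) ^ 2 ≤ (K - 1) * mOut ^ 2 := by
      rw [hKdef]
      linarith only [hsq']
    have hK1 : 0 ≤ K - 1 := by
      rw [hKdef]
      linarith only [sq_nonneg c₁, sq_nonneg (c₂ + κ)]
    have hmm : mOut ^ 2 ≤ m₀ * mOut := by
      rw [sq]
      exact mul_le_mul_of_nonneg_right hle hmOut.le
    have hB : (K - 1) * mOut ^ 2 ≤ (K - 1) * (m₀ * mOut) := mul_le_mul_of_nonneg_left hmm hK1
    have hKm : m₀ * K * mOut ≤ μo * mOut := mul_le_mul_of_nonneg_right hKm₀ hmOut.le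
    have hm₀m : 0 < m₀ * mOut := mul_pos hm₀pos hmOut
    have hC : (K - 1) * (m₀ * mOut) < μo * mOut := by linarith only [hKm, hm₀m]
    have hD : μo * mOut ≤ μo * (avgE η 32 gOut - avgE η 1 (schwField mIn)) :=
      mul_le_mul_of_nonneg_left (by linarith only [hΔlo, hmOut]) hμo.le
    linarith only [hA, hB, hC, hD]
  unfold MOTHyp
  exact ⟨hdevIn, hdevOut, i1, i2, i3, i4, i5⟩

end Summit.FinalStateConjecture.FinalStateConjecture.Theorems.SwallowTheDatum.ParametricKerrBurial

end
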